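import Literature.Barriers.MatrixMultiplication.RectangularBarrierAlphaMaMu
import Literature.Barriers.MatrixMultiplication.IrreversibilityBarrier
import Literature.Computability.AlgebraicComplexity.FlagSupportBounds
import HarnessLib

/-!
# The CLLZ barrier chain for one reduction `CW_q^{⊗k} ≥ ⟨s⟩ ⊗ ⟨n,n,m⟩`

Topic `Literature/Barriers/MatrixMultiplication`; second proof file towards the named fact
`CLLZ2025_alpha_barrier_CW` of `RectangularBarrier.lean`. For one reduction of a `CW_q`-method
(CLLZ Def. 3.9: `CW_q^{⊗k} ≥ ⟨n,n,m⟩^{⊕s}`, restriction) this file proves the inequality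
`log F(⟨n,n,m⟩^{⊕s}) ≤ log F(CW_q^{⊗k}) ≤ k log F(CW_q)` of the proof of CLLZ Thm. 3.10 for the
flag-form upper support functional, with both ends evaluated:

* `le_mul_of_reduction_of_cost` — for `θ ≥ 0` and any positive sub-probability certificate
  `Q₁, Q₂, Q₃` on `Fin (q+2)` whose cost is `≤ V` on `supp CW_q`:
  `θ₀ log₂(snm) + θ₁ log₂(sn²) + θ₂ log₂(snm) ≤ k V`.
  Chain: the bound for the oblique tensor `⟨s⟩ ⊗ ⟨n,n,m⟩` in every frame
  (`le_frame_unitKroneckerMatMul_lex`, Strassen's comparison), monotonicity of the flag support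
  entropy under the restriction (`exists_frame_le_of_restriction`), and the product bound for
  `CW_q^{⊗k}` from the certificate (`exists_frame_kroneckerPow_le`).
* `bigCwTensor_ne_zero_iff` — the support of `CW_q` (the six orbits of CLLZ §4.3).
* `cw_cost_eq` and `cw_chain_bound` — the certificate of CLLZ §4.3–4.4 made explicit for the
  `α`-barrier: with `θ = (ε/2, 1−ε, ε/2)`, `Q₁ = Q₃ = (x; y,…,y; y²/x)` and
  `Q₂ ∝ (1; e^{−τΔ/2},…; e^{−τΔ})`, `τ = ε/(1−ε)`, `Δ = log x − log y`, every support point of `CW_q`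
  has the same cost, whence
  `log s + (2−ε) log n + ε log m ≤ k (ε log(1/y) + (1−ε) log(1 + q e^{−τΔ/2} + e^{−τΔ}))`.

No definitions are introduced.

## References

* M. Christandl, F. Le Gall, V. Lysikov, J. Zuiddam, comput. complexity 34 (2025), Thm. 3.10,
  §4.3–4.4. [ChristandlLeGallLysikovZuiddam2025]
-/

noncomputable section

open scoped BigOperators

namespace Literature.Barriers.MatrixMultiplication

open Literature.Computability.AlgebraicComplexity

universe u

/-! ## The chain for an arbitrary certificate -/

section Chain

variable (K : Type u) [Field K]

/-- **The barrier chain for one reduction** (proof of CLLZ Thm. 3.10 for the flag-form support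
functional): if `CW_q^{⊗k} ≥ ⟨s⟩ ⊗ ⟨n,n,m⟩` (restriction; `s, n, m ≥ 1`), `θ ≥ 0`, and positive
sub-probability vectors `Q₁, Q₂, Q₃` on `Fin (q+2)` have cost
`θ₀ log₂(1/Q₁(a)) + θ₁ log₂(1/Q₂(b)) + θ₂ log₂(1/Q₃(c)) ≤ V` at every support point `(a,b,c)` of `CW_q`
(`V ≥ 0`), then `θ₀ log₂(snm) + θ₁ log₂(sn²) + θ₂ log₂(snm) ≤ k V`.
[cite: ChristandlLeGallLysikovZuiddam2025, Thm. 3.10 (proof)] -/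
theorem le_mul_of_reduction_of_cost {q k n m s : ℕ} (hn : 0 < n) (hm : 0 < m) (hs : 0 < s)
    (hred : IsTMethodReduction K (bigCwTensor K q) k n m s) {θ : Fin 3 → ℝ} (hθ : ∀ i, 0 ≤ θ i)
    {Q₁ Q₂ Q₃ : Fin (q + 2) → ℝ} (hQ₁ : ∀ a, 0 < Q₁ a) (hQ₁' : ∑ a, Q₁ a ≤ 1)
    (hQ₂ : ∀ b, 0 < Q₂ b) (hQ₂' : ∑ b, Q₂ b ≤ 1) (hQ₃ : ∀ c, 0 < Q₃ c) (hQ₃' : ∑ c, Q₃ c ≤ 1)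
    {V : ℝ} (hV0 : 0 ≤ V)
    (hV : ∀ a b c, bigCwTensor K q a b c ≠ 0 → θ 0 * (-Real.log (Q₁ a) / Real.log 2) +
      θ 1 * (-Real.log (Q₂ b) / Real.log 2) + θ 2 * (-Real.log (Q₃ c) / Real.log 2) ≤ V) :
    θ 0 * (Real.log ((s : ℝ) * n * m) / Real.log 2) + θ 1 * (Real.log ((s : ℝ) * n * n) / Real.log 2) +
        θ 2 * (Real.log ((s : ℝ) * n * m) / Real.log 2) ≤ k * V := by
  classical
  -- the restriction matrices of the reduction
  obtain ⟨X, Y, Z, hXYZ⟩ := (tensorRestrictsTo_iff_exists_actTensor _ _).1 hred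
  -- a frame of `CW_q^{⊗k}` evaluating the certificate
  obtain ⟨A, B, C, hA, hB, hC, hH⟩ :=
    exists_frame_kroneckerPow_le (bigCwTensor K q) k hθ hQ₁ hQ₁' hQ₂ hQ₂' hQ₃ hQ₃' hV0 hV
  -- the restriction matrices, reindexed by the lexicographic synonyms
  let X' : Matrix (Lex (Fin s × Lex (Fin n × Fin m))) (Fin k → Fin (q + 2)) K :=
    fun a => X ((ofLex a).1, ((ofLex (ofLex a).2).1, (ofLex (ofLex a).2).2))
  let Y' : Matrix (Lex (Fin s × Lex ((Fin n)ᵒᵈ × Fin n))) (Fin k → Fin (q + 2)) K :=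
    fun b => Y ((ofLex b).1, (OrderDual.ofDual (ofLex (ofLex b).2).1, (ofLex (ofLex b).2).2))
  let Z' : Matrix (Lex (Fin s × Lex (Fin n × Fin m)))ᵒᵈ (Fin k → Fin (q + 2)) K :=
    fun c => Z ((ofLex (OrderDual.ofDual c)).1, ((ofLex (ofLex (OrderDual.ofDual c)).2).1,
      (ofLex (ofLex (OrderDual.ofDual c)).2).2))
  -- monotonicity: a frame of the reindexed restriction below the frame of `CW_q^{⊗k}`
  obtain ⟨M₁, M₂, M₃, A', B', C', hA', hB', hC', hH'⟩ :=
    exists_frame_le_of_restriction hθ (kroneckerPow (bigCwTensor K q) k) A B C hA hB hC X' Y' Z'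
  -- the reindexed `⟨s⟩ ⊗ ⟨n,n,m⟩` is this restriction
  have ht' : (fun (a : Lex (Fin s × Lex (Fin n × Fin m))) (b : Lex (Fin s × Lex ((Fin n)ᵒᵈ × Fin n)))
      (c : (Lex (Fin s × Lex (Fin n × Fin m)))ᵒᵈ) =>
      kroneckerTensor (unitTensor K s) (matMulTensor K n n m)
        ((ofLex a).1, ((ofLex (ofLex a).2).1, (ofLex (ofLex a).2).2))
        ((ofLex b).1, (OrderDual.ofDual (ofLex (ofLex b).2).1, (ofLex (ofLex b).2).2))
        ((ofLex (OrderDual.ofDual c)).1, ((ofLex (ofLex (OrderDual.ofDual c)).2).1,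
          (ofLex (ofLex (OrderDual.ofDual c)).2).2))) =
      actTensor X' Y' Z' (kroneckerPow (bigCwTensor K q) k) := by
    funext a b c
    rw [hXYZ]
    rfl
  -- the oblique tensor bounds every frame from below
  have h1 := le_frame_unitKroneckerMatMul_lex K hs hn hm hθ A' B' C' hA' hB' hC'
  rw [ht'] at h1
  exact h1.trans (hH'.trans hH)

end Chain

/-! ## The support of `CW_q` and the certificate -/

section Certificate

variable (K : Type u) [Field K]

/-- The support of `CW_q` consists of the six orbits `(0,i,i)`, `(i,0,i)`, `(i,i,0)` (`1 ≤ i ≤ q`),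
`(0,0,q+1)`, `(0,q+1,0)`, `(q+1,0,0)` (CLLZ §4.3). [cite: ChristandlLeGallLysikovZuiddam2025, §4.3] -/
theorem bigCwTensor_ne_zero_iff (q : ℕ) (a b c : Fin (q + 2)) :
    bigCwTensor K q a b c ≠ 0 ↔
      (a = 0 ∧ b = c ∧ b ≠ 0 ∧ b ≠ Fin.last (q + 1)) ∨ (b = 0 ∧ a = c ∧ a ≠ 0 ∧ a ≠ Fin.last (q + 1)) ∨
        (c = 0 ∧ a = b ∧ a ≠ 0 ∧ a ≠ Fin.last (q + 1)) ∨ (a = 0 ∧ b = 0 ∧ c = Fin.last (q + 1)) ∨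
        (a = 0 ∧ b = Fin.last (q + 1) ∧ c = 0) ∨ (a = Fin.last (q + 1) ∧ b = 0 ∧ c = 0) := by
  rw [bigCwTensor_apply]
  constructor
  · intro h
    by_contra hc
    exact h (if_neg hc)
  · intro h
    rw [if_pos h]
    exact one_ne_zero

omit [Field K] in
/-- Splitting a sum over `Fin (q+2)` into the first term, the `q` middle terms and the last term.
[folklore] -/
theorem sum_fin_add_two {M : Type*} [AddCommMonoid M] (q : ℕ) (f : Fin (q + 2) → M) :
    ∑ i, f i = f 0 + ∑ i : Fin q, f i.castSucc.succ + f (Fin.last (q + 1)) := by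
  rw [Fin.sum_univ_succ, Fin.sum_univ_castSucc]
  exact (add_assoc _ _ _).symm

omit [Field K] in
/-- A middle index `i.castSucc.succ` of `Fin (q+2)` is neither `0` nor the last index. [folklore] -/
theorem castSucc_succ_ne (q : ℕ) (i : Fin q) :
    (i.castSucc.succ : Fin (q + 2)) ≠ 0 ∧ (i.castSucc.succ : Fin (q + 2)) ≠ Fin.last (q + 1) := by
  refine ⟨Fin.succ_ne_zero _, ?_⟩
  rw [Fin.succ_castSucc]
  exact (Fin.castSucc_lt_last _).ne

omit [Field K] in
/-- The last index of `Fin (q+2)` is not `0`. [folklore] -/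
theorem last_ne_zero (q : ℕ) : (Fin.last (q + 1) : Fin (q + 2)) ≠ 0 := by
  simp [Fin.ext_iff]

/-- **The `α`-certificate has constant cost on `supp CW_q`** (CLLZ §4.3–4.4, the `S_q`-symmetric
dual solution, written out): for `0 < y ≤ x`, `0 < ε < 1`, `τ = ε/(1−ε)`, `Δ = log x − log y`, the
vectors `Qa = (x; y,…,y; y²/x)` and `w = (1; e^{−τΔ/2},…,e^{−τΔ/2}; e^{−τΔ})` satisfy
`(ε/2)(log(1/Qa(a)) + log(1/Qa(c))) + (1−ε)·τ ν(b) = ε log(1/y)` at every support point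
`(a, b, c)` of `CW_q`, where `w(b) = e^{−τ ν(b)}`. [cite: ChristandlLeGallLysikovZuiddam2025, §4.4] -/
theorem cw_cost_eq {q : ℕ} {x y ε : ℝ} (hy : 0 < y) (hyx : y ≤ x) (hε1 : ε < 1) {a b c : Fin (q + 2)}
    (h : bigCwTensor K q a b c ≠ 0) :
    ε / 2 * (-Real.log (if a = 0 then x else if a = Fin.last (q + 1) then y ^ 2 / x else y) +
        -Real.log (if c = 0 then x else if c = Fin.last (q + 1) then y ^ 2 / x else y)) +
      (1 - ε) * (ε / (1 - ε) *
        (if b = 0 then 0 else if b = Fin.last (q + 1) then Real.log x - Real.log y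
          else (Real.log x - Real.log y) / 2)) = ε * -Real.log y := by
  have hx : 0 < x := hy.trans_le hyx
  have hε' : (1 - ε) ≠ 0 := by linarith
  have hl : Real.log (y ^ 2 / x) = 2 * Real.log y - Real.log x := by
    rw [Real.log_div (pow_pos hy 2).ne' hx.ne', Real.log_pow]
    push_cast
    ring
  have hl0 := last_ne_zero q
  rw [bigCwTensor_ne_zero_iff] at h
  rcases h with ⟨rfl, rfl, h0, hl'⟩ | ⟨rfl, rfl, h0, hl'⟩ | ⟨rfl, rfl, h0, hl'⟩ | ⟨rfl, rfl, rfl⟩ |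
    ⟨rfl, rfl, rfl⟩ | ⟨rfl, rfl, rfl⟩
  · simp only [if_true, if_neg h0, if_neg hl']
    field_simp
    ring
  · simp only [if_true, if_neg h0, if_neg hl']
    field_simp
    ring
  · simp only [if_true, if_neg h0, if_neg hl']
    field_simp
    ring
  · simp only [if_true, if_neg hl0, hl]
    field_simp
    ring
  · simp only [if_true, if_neg hl0]
    field_simp
    ring
  · simp only [if_true, if_neg hl0, hl]
    field_simp
    ring

/-- **The chain with the `α`-certificate** (CLLZ Thm. 3.10 with the dual solution of §4.3–4.4 for
`θ = (ε/2, 1−ε, ε/2)`): for `0 < y ≤ x` with `x + q y + y²/x ≤ 1`, `0 < ε < 1` and every reduction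
`CW_q^{⊗k} ≥ ⟨s⟩ ⊗ ⟨n,n,m⟩` (`s, n, m ≥ 1`),
`log s + (2 − ε) log n + ε log m ≤ k (ε log(1/y) + (1 − ε) log(1 + q e^{−τΔ/2} + e^{−τΔ}))`,
`τ = ε/(1−ε)`, `Δ = log x − log y`. [cite: ChristandlLeGallLysikovZuiddam2025, Thm. 3.10 and §4.4] -/
theorem cw_chain_bound {q : ℕ} {x y ε : ℝ} (hy : 0 < y) (hyx : y ≤ x)
    (hfeas : x + q * y + y ^ 2 / x ≤ 1) (hε : 0 < ε) (hε1 : ε < 1) {k n m s : ℕ} (hn : 0 < n)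
    (hm : 0 < m) (hs : 0 < s) (hred : IsTMethodReduction K (bigCwTensor K q) k n m s) :
    Real.log s + (2 - ε) * Real.log n + ε * Real.log m ≤
      k * (ε * -Real.log y + (1 - ε) * Real.log (1 + q * Real.exp (-(ε / (1 - ε) *
        (Real.log x - Real.log y) / 2)) + Real.exp (-(ε / (1 - ε) * (Real.log x - Real.log y))))) := by
  have hx : 0 < x := hy.trans_le hyx
  have hε' : 0 < 1 - ε := by linarith
  have hL2 : 0 < Real.log 2 := Real.log_pos one_lt_two
  have hs' : (0 : ℝ) < s := by exact_mod_cast hs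
  have hn' : (0 : ℝ) < n := by exact_mod_cast hn
  have hm' : (0 : ℝ) < m := by exact_mod_cast hm
  -- the certificate
  set τ : ℝ := ε / (1 - ε) with hτ
  set Δ : ℝ := Real.log x - Real.log y with hΔ
  let Qa : Fin (q + 2) → ℝ := fun i => if i = 0 then x else if i = Fin.last (q + 1) then y ^ 2 / x else y
  let ν : Fin (q + 2) → ℝ := fun i => if i = 0 then 0 else if i = Fin.last (q + 1) then Δ else Δ / 2
  let w : Fin (q + 2) → ℝ := fun i => Real.exp (-(τ * ν i))
  set W : ℝ := ∑ i, w i with hW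
  let Qb : Fin (q + 2) → ℝ := fun i => w i / W
  have hQa : ∀ i, 0 < Qa i := by
    intro i
    simp only [Qa]
    split_ifs
    · exact hx
    · positivity
    · exact hy
  have hQa' : ∑ i, Qa i ≤ 1 := by
    rw [sum_fin_add_two]
    have hmid : ∀ i : Fin q, Qa i.castSucc.succ = y := fun i => by
      simp only [Qa, if_neg (castSucc_succ_ne q i).1, if_neg (castSucc_succ_ne q i).2]
    simp only [hmid, Finset.sum_const, Finset.card_univ, Fintype.card_fin, nsmul_eq_mul]
    simp only [Qa, if_true, if_neg (last_ne_zero q)]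
    linarith
  have hw : ∀ i, 0 < w i := fun i => Real.exp_pos _
  have hW0 : 0 < W := Finset.sum_pos (fun i _ => hw i) Finset.univ_nonempty
  have hQb : ∀ i, 0 < Qb i := fun i => div_pos (hw i) hW0
  have hQb' : ∑ i, Qb i ≤ 1 := by
    simp only [Qb, ← Finset.sum_div]
    rw [← hW, div_self hW0.ne']
  have hWeq : W = 1 + q * Real.exp (-(ε / (1 - ε) * (Real.log x - Real.log y) / 2)) +
      Real.exp (-(ε / (1 - ε) * (Real.log x - Real.log y))) := by
    rw [hW, sum_fin_add_two]
    have hmid : ∀ i : Fin q, w i.castSucc.succ =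
        Real.exp (-(ε / (1 - ε) * (Real.log x - Real.log y) / 2)) := fun i => by
      simp only [w, ν, if_neg (castSucc_succ_ne q i).1, if_neg (castSucc_succ_ne q i).2, hτ, hΔ]
      congr 1
      ring
    simp only [hmid, Finset.sum_const, Finset.card_univ, Fintype.card_fin, nsmul_eq_mul]
    simp only [w, ν, if_true, if_neg (last_ne_zero q), mul_zero, neg_zero, Real.exp_zero, hτ, hΔ]
  -- the weights
  let θ : Fin 3 → ℝ := ![ε / 2, 1 - ε, ε / 2]
  have hθ : ∀ i, 0 ≤ θ i := by
    intro i
    fin_cases i <;> simp [θ] <;> linarith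
  have hθ0 : θ 0 = ε / 2 := rfl
  have hθ1 : θ 1 = 1 - ε := rfl
  have hθ2 : θ 2 = ε / 2 := rfl
  -- the value of the certificate
  set Λ : ℝ := ε * -Real.log y + (1 - ε) * Real.log W with hΛ
  have hy1 : y ≤ 1 := by
    have h1 : x ≤ 1 := by
      have : 0 ≤ (q : ℝ) * y := by positivity
      have : 0 ≤ y ^ 2 / x := by positivity
      linarith
    exact hyx.trans h1
  have hW1 : 1 ≤ W := by
    rw [hWeq]
    have : 0 ≤ (q : ℝ) * Real.exp (-(ε / (1 - ε) * (Real.log x - Real.log y) / 2)) := by positivity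
    have : 0 ≤ Real.exp (-(ε / (1 - ε) * (Real.log x - Real.log y))) := by positivity
    linarith
  have hΛ0 : 0 ≤ Λ := by
    have : 0 ≤ -Real.log y := by
      rw [neg_nonneg]
      exact Real.log_nonpos hy.le hy1
    have : 0 ≤ Real.log W := Real.log_nonneg hW1
    positivity
  -- the cost is constant `= Λ / log 2` on the support
  have hcost : ∀ a b c, bigCwTensor K q a b c ≠ 0 → θ 0 * (-Real.log (Qa a) / Real.log 2) +
      θ 1 * (-Real.log (Qb b) / Real.log 2) + θ 2 * (-Real.log (Qa c) / Real.log 2) ≤ Λ / Real.log 2 := by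
    intro a b c habc
    have hb : -Real.log (Qb b) = τ * ν b + Real.log W := by
      simp only [Qb, w]
      rw [Real.log_div (Real.exp_pos _).ne' hW0.ne', Real.log_exp]
      ring
    rw [hθ0, hθ1, hθ2, hb]
    have key := cw_cost_eq K (q := q) hy hyx hε1 habc
    have e : ε / 2 * (-Real.log (Qa a) / Real.log 2) + (1 - ε) * ((τ * ν b + Real.log W) / Real.log 2) +
        ε / 2 * (-Real.log (Qa c) / Real.log 2) =
        ((ε / 2 * (-Real.log (Qa a) + -Real.log (Qa c)) + (1 - ε) * (τ * ν b)) +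
          (1 - ε) * Real.log W) / Real.log 2 := by ring
    rw [e, key, hΛ]
  -- the chain
  have hmain := le_mul_of_reduction_of_cost K hn hm hs hred hθ hQa hQa' hQb hQb' hQa hQa'
    (div_nonneg hΛ0 hL2.le) hcost
  rw [hθ0, hθ1, hθ2] at hmain
  have hlogs : Real.log ((s : ℝ) * n * m) = Real.log s + Real.log n + Real.log m := by
    rw [Real.log_mul (by positivity) hm'.ne', Real.log_mul hs'.ne' hn'.ne']
  have hlogn : Real.log ((s : ℝ) * n * n) = Real.log s + Real.log n + Real.log n := by
    rw [Real.log_mul (by positivity) hn'.ne', Real.log_mul hs'.ne' hn'.ne']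
  rw [hlogs, hlogn] at hmain
  have hmain' : (Real.log s + (2 - ε) * Real.log n + ε * Real.log m) / Real.log 2 ≤
      k * Λ / Real.log 2 := by
    have e1 : (Real.log s + (2 - ε) * Real.log n + ε * Real.log m) / Real.log 2 =
        ε / 2 * ((Real.log s + Real.log n + Real.log m) / Real.log 2) +
          (1 - ε) * ((Real.log s + Real.log n + Real.log n) / Real.log 2) +
          ε / 2 * ((Real.log s + Real.log n + Real.log m) / Real.log 2) := by
      field_simp
      ring
    rw [e1, mul_div_assoc]
    exact hmain
  rw [div_le_div_iff_of_pos_right hL2] at hmain'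
  rw [← hWeq]
  exact hmain'

end Certificate

end Literature.Barriers.MatrixMultiplication

end
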